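import Literature.NumberTheory.EllipticCurves.TwistedHeegnerModule
import HarnessLib

/-!
# Galois behaviour of the transport `θ_C : E′(K̄) ≃ E(K̄)` of a twisted Heegner family
# (Silverman X.2, proof of Thm. 2.2: the conjugate isomorphism `ι^σ`) — theorems + one definition

Cross-ladder LITERATURE-TYPING layer (D-0088(4)), cell `bsd-littype`, seat `bsd-littype-06` (gen 3).
Sequel of `TwistedHeegnerModule.lean` (same seat): the bookkeeping that the NON-VACUITY of
`TwistedHeegnerFamily` needs (HOME `OPEN-QUESTIONS-06.md` Q-D4, item (d)): for a `K̄`-isomorphism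
`T : GeomTransport W′ W K` (change of variables `C` over `K̄` with `C • E′_{K̄} = E_{K̄}`) and
`σ ∈ Γ_K`, the conjugate `T.mapGal σ` (coefficients `σC`; again a `GeomTransport`, since both curves
are defined over `K`) satisfies **`σ(θ_C(x)) = θ_{σC}(σx)`** (`smul_equiv`); hence `θ_C` is
`σ`-equivariant whenever `σ` fixes the coefficients of `C` (`smul_equiv_of_map_eq`), and a point
fixed by a subgroup `H ≤ Γ_K` that fixes `C` is carried to a point fixed by `H`
(`smul_equiv_eq_self_of`) — the shape of the `K[c]`-rationality clause of `IsTwistedHeegnerNormPoint`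
(for the quadratic twist `C` has coordinates in `K(√p*) ⊆ K[p] ⊆ K[c]`, fact
`sqrt_pStar_mem_ringClassField` of `RingClassGenusCharacter.lean`). Nothing is asserted beyond these
proved identities; the remaining inputs of non-vacuity (Heegner points of `E′`,
`exists_isHeegnerNormPoint N′ W′ K p`; `K[p] ⊆ K[c]` for `p ∣ c` in the `jbar`-singular-moduli sense)
are listed in Q-D4.

References: [SilvermanAEC2009] III.1 Table 3.1 (substitution formulas), X.2 Thm. 2.2 (proof: `ι^σ`),
X.5 Cor. 5.4 (quadratic twists). Mathlib: `WeierstrassCurve.map_baseChange`, `map_variableChange`.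
-/

set_option autoImplicit false

noncomputable section

open scoped Classical

universe u v w

namespace Literature.NumberTheory.EllipticCurves.GeomTransport

open WeierstrassCurve

/-- A ring homomorphism carries the new `x`-coordinate of `C` to that of `C.map f`:
`f(u⁻²(x − r)) = (f u)⁻²(f x − f r)`. Silverman III.1 Table 3.1 (the substitution formulas are
polynomial in the data). [cite: SilvermanAEC2009, III.1 Table 3.1] -/
theorem ringHom_toX {R : Type v} {S : Type w} [CommRing R] [CommRing S] (C : VariableChange R)
    (f : R →+* S) (x : R) : f (C.toX x) = (C.map f).toX (f x) := by
  simp only [VariableChange.toX_def, VariableChange.map, Units.coe_map_inv, MonoidHom.coe_coe,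
    map_mul, map_pow, map_sub]

/-- A ring homomorphism carries the new `y`-coordinate of `C` to that of `C.map f`.
[cite: SilvermanAEC2009, III.1 Table 3.1] -/
theorem ringHom_toY {R : Type v} {S : Type w} [CommRing R] [CommRing S] (C : VariableChange R)
    (f : R →+* S) (x y : R) : f (C.toY x y) = (C.map f).toY (f x) (f y) := by
  simp only [VariableChange.toY_def, VariableChange.map, Units.coe_map_inv, MonoidHom.coe_coe,
    map_mul, map_pow, map_sub]

variable {W' W : WeierstrassCurve ℚ} {K : Type u} [Field K] [NumberField K]
  (T : GeomTransport W' W K)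

/-- `σ ∈ Γ_K` as a `K`-algebra homomorphism of `K̄` (the tree's identity `toAlgEquiv`, then the
underlying algebra hom) — plumbing for `VariableChange.map` and `Affine.Point.map`. [folklore] -/
def galHom (σ : Field.absoluteGaloisGroup K) : AlgebraicClosure K →ₐ[K] AlgebraicClosure K :=
  (Field.absoluteGaloisGroup.toAlgEquiv K σ).toAlgHom

omit [NumberField K] in
/-- The Galois action on geometric points is `Affine.Point.map` of `galHom σ` (the tree's
`smul_def` for the action on `E(K̄)`; Silverman VIII.§1: `P ↦ P^σ` on coordinates).
[cite: SilvermanAEC2009, VIII.§1 (the action of G_{K̄/K} on E(K̄))] -/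
theorem smul_eq_map_galHom (V : WeierstrassCurve K) (σ : Field.absoluteGaloisGroup K)
    (P : geomPoints V) : σ • P = Affine.Point.map (galHom σ) P :=
  rfl

omit [NumberField K] in
/-- The base change of a curve over `K` to `K̄` is fixed by `σ ∈ Γ_K` (Mathlib `map_baseChange`);
Silverman X.2, proof of Thm. 2.2 (`E` is defined over `K`, so `E^σ = E`).
[cite: SilvermanAEC2009, X.2 Thm. 2.2 (proof)] -/
theorem map_galHom_baseChange (V : WeierstrassCurve K) (σ : Field.absoluteGaloisGroup K) :
    (V.baseChange (AlgebraicClosure K)).map (galHom σ : AlgebraicClosure K →+* AlgebraicClosure K) =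
      V.baseChange (AlgebraicClosure K) :=
  map_baseChange V (galHom σ)

/-- **The conjugate transport `θ_C^σ = θ_{σC}`** for `σ ∈ Γ_K`: `σ` applied to the coefficients of
`C` is again a `K̄`-isomorphism `E′_{K̄} ≅ E_{K̄}` (both curves are defined over `K`, so `σ` fixes
them: Mathlib `map_baseChange`, `map_variableChange`). Silverman X.2, proof of Thm. 2.2 (`ι^σ`).
[cite: SilvermanAEC2009, X.2 Thm. 2.2 (proof: the conjugate isomorphism ι^σ)] -/
def mapGal (σ : Field.absoluteGaloisGroup K) : GeomTransport W' W K where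
  C := T.C.map (galHom σ : AlgebraicClosure K →+* AlgebraicClosure K)
  smul_eq := by
    have h : (T.C • (W'.baseChange K).baseChange (AlgebraicClosure K)).map
          (galHom σ : AlgebraicClosure K →+* AlgebraicClosure K) =
        ((W.baseChange K).baseChange (AlgebraicClosure K)).map
          (galHom σ : AlgebraicClosure K →+* AlgebraicClosure K) :=
      congrArg (fun V : WeierstrassCurve (AlgebraicClosure K) ↦
        V.map (galHom σ : AlgebraicClosure K →+* AlgebraicClosure K)) T.smul_eq
    rw [← map_variableChange, map_galHom_baseChange, map_galHom_baseChange] at h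
    exact h

/-- The coefficients of the conjugate transport (by definition).
[cite: SilvermanAEC2009, X.2 Thm. 2.2 (proof)] -/
theorem mapGal_C (σ : Field.absoluteGaloisGroup K) :
    (T.mapGal σ).C = T.C.map (galHom σ : AlgebraicClosure K →+* AlgebraicClosure K) :=
  rfl

/-- If `σ` fixes the coefficients of `C` then the conjugate transport is the transport itself.
[cite: SilvermanAEC2009, X.2 Thm. 2.2 (proof)] -/
theorem mapGal_eq_self_of {σ : Field.absoluteGaloisGroup K}
    (hσ : T.C.map (galHom σ : AlgebraicClosure K →+* AlgebraicClosure K) = T.C) :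
    T.mapGal σ = T := by
  obtain ⟨C, hC⟩ := T
  simp only [mapGal, GeomTransport.mk.injEq]
  exact hσ

/-- `θ_C` on an affine point: `(x, y) ↦ (u⁻²(x − r), u⁻³(y − s(x − r) − t))`.
[cite: SilvermanAEC2009, III.1 Table 3.1] -/
theorem equiv_some {a b : AlgebraicClosure K}
    (h : ((W'.baseChange K).baseChange (AlgebraicClosure K)).toAffine.Nonsingular a b) :
    T.equiv (.some a b h) = .some (T.C.toX a) (T.C.toY a b)
      (T.smul_eq ▸ (VariableChange.nonsingular_iff _ T.C a b).mpr h) := by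
  change Affine.Point.congrEquiv T.smul_eq
      (VariableChange.pointEquiv ((W'.baseChange K).baseChange (AlgebraicClosure K)) T.C
        (.some a b h)) = _
  rw [VariableChange.pointEquiv_some, Affine.Point.congrEquiv_some]

/-- **Galois behaviour of the transport: `σ(θ_C(x)) = θ_{σC}(σ x)`** for `σ ∈ Γ_K` and
`x ∈ E′(K̄)` — the basic identity behind the twisting cocycle `σ ↦ θ_{σC} ∘ θ_C⁻¹` (Silverman X.2,
proof of Thm. 2.2: "`ι^σ`"; for the quadratic twist `θ_{σC} = χ(σ) θ_C`, X.5 Cor. 5.4). Coordinates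
are polynomial in `(x, y)` and the data of `C` (`ringHom_toX`, `ringHom_toY`).
[cite: SilvermanAEC2009, X.2 Thm. 2.2 (proof) and X.5 Cor. 5.4] -/
theorem smul_equiv (σ : Field.absoluteGaloisGroup K) (x : geomPoints (W'.baseChange K)) :
    σ • T.equiv x = (T.mapGal σ).equiv (σ • x) := by
  rw [smul_eq_map_galHom, smul_eq_map_galHom]
  cases x with
  | zero =>
    change Affine.Point.map (galHom σ) (T.equiv 0) = (T.mapGal σ).equiv 0
    rw [map_zero, map_zero]
    exact map_zero _
  | @some a b h =>
    change Affine.Point.map (galHom σ) (T.equiv (.some a b h)) =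
      (T.mapGal σ).equiv (Affine.Point.map (galHom σ) (.some a b h))
    rw [equiv_some, Affine.Point.map_some, Affine.Point.map_some, equiv_some]
    simp only [mapGal_C, Affine.Point.some.injEq]
    exact ⟨ringHom_toX T.C _ _, ringHom_toY T.C _ _ _⟩

/-- **Equivariance where `C` is fixed**: if `σ ∈ Γ_K` fixes the coefficients of `C` then
`σ(θ_C(x)) = θ_C(σ x)`. [cite: SilvermanAEC2009, X.2 Thm. 2.2 (proof)] -/
theorem smul_equiv_of_map_eq {σ : Field.absoluteGaloisGroup K}
    (hσ : T.C.map (galHom σ : AlgebraicClosure K →+* AlgebraicClosure K) = T.C)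
    (x : geomPoints (W'.baseChange K)) : σ • T.equiv x = T.equiv (σ • x) := by
  rw [smul_equiv, mapGal_eq_self_of T hσ]

/-- **Rationality transfer**: if a subgroup `H ≤ Γ_K` fixes the coefficients of `C` and fixes
`x ∈ E′(K̄)`, then it fixes `θ_C(x) ∈ E(K̄)` — the shape of the clause
"`∀ σ ∈ ringClassSubgroup K c jbar, σ • T.equiv x′ = T.equiv x′`" of `IsTwistedHeegnerNormPoint`
(for the quadratic twist: `C` has coordinates in `K(√p*) ⊆ K[p] ⊆ K[c]`,
`sqrt_pStar_mem_ringClassField`). [cite: SilvermanAEC2009, X.2 Thm. 2.2 (proof) and X.5 Cor. 5.4] -/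
theorem smul_equiv_eq_self_of {H : Subgroup (Field.absoluteGaloisGroup K)}
    (hC : ∀ σ ∈ H, T.C.map (galHom σ : AlgebraicClosure K →+* AlgebraicClosure K) = T.C)
    {x : geomPoints (W'.baseChange K)} (hx : ∀ σ ∈ H, σ • x = x) :
    ∀ σ ∈ H, σ • T.equiv x = T.equiv x := fun σ hσ ↦ by
  rw [T.smul_equiv_of_map_eq (hC σ hσ), hx σ hσ]

end Literature.NumberTheory.EllipticCurves.GeomTransport

end
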